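import Literature.Computability.Cryptography.VanDamSeroussiCubicBlockMeasure
import Literature.Computability.Cryptography.VanDamSeroussiReplicatedFourier
import Literature.Computability.Cryptography.VanDamSeroussiPhaseGrid
import HarnessLib

/-!
# The quantum block of the cubic Gauss-sum experiment, V: the interference term is a replicated-Fourier inner product

Topic `Literature/Computability/Cryptography`; sequel of `VanDamSeroussiCubicBlockMeasure.lean` (the
block statistic `P(c = 0, T) − P(c = 1, T)` in terms of the branch amplitudes `a₀`, `a₁`) and of
`VanDamSeroussiReplicatedFourier.lean` (the repetition kernel `dirichletSum`, the transform
`repFourier`). Here the two meet (van Dam–Seroussi 2002, §4, proof of Thm. 1, with the Fourier-basis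
read-out realised as Kitaev's eigenvalue measurement, Kitaev 1995 §3, §5): summing the interference
term over the moved value `u` is a Parseval sum over the frequencies `f` of `ℤ/N`,

`Σ_u conj(a₀ γ u) · a₁ γ u = N⁻¹ Σ_f |2^k modeAmp σ w N f γ|² · conj(S f) · R f`

(`LAW₁`: `S = dirichletSum N 2^λ p`, `R = repFourier N 2^λ p 1_{C}` the transform of the indicator of
the coset; `|modeAmp|²` the product law of Kitaev's tests at eigenphase `f/N`).

Everything here is proved; no named fact is introduced.

## References

* W. van Dam, G. Seroussi, arXiv:quant-ph/0207131 (2002), §4 Thm. 1 (proof) [VanDamSeroussi2002].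
* A. Yu. Kitaev, arXiv:quant-ph/9511026 (1995), §3 Lemma 8, §5 [Kitaev1995].
-/

noncomputable section

namespace Literature.Computability.Cryptography

namespace VanDamSeroussi

namespace CubicBlock

open _root_.Computability Complexity QuantumComplexity Kitaev1995 Finset Complex
open Literature.Computability.QuantumComplexity.QFTQubits

/-! ### Finite Fourier bookkeeping -/

/-- Residues agree iff the order-`N` phase average is `1`:
`[a ≡ b (mod N)] · x = N⁻¹ Σ_{f<N} e(f(b−a)/N) · x`. [folklore] -/
theorem ite_mod_eq_avg {N : ℕ} (hN : 0 < N) (a b : ℕ) (x : ℂ) :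
    (if a % N = b % N then x else 0) = (N : ℂ)⁻¹ * (∑ f ∈ range N, eR ((((b : ℤ) - a : ℤ) : ℝ) * f / N)) * x := by
  rw [sum_eR_int_mul_div hN]
  have hiff : a % N = b % N ↔ (N : ℤ) ∣ ((b : ℤ) - a) := (Nat.modEq_iff_dvd (n := N) (a := a) (b := b))
  by_cases h : a % N = b % N
  · rw [if_pos h, if_pos (hiff.1 h), inv_mul_cancel₀ (by exact_mod_cast hN.ne'), one_mul]
  · rw [if_neg h, if_neg (fun h' => h (hiff.2 h')), mul_zero, zero_mul]

/-- **Parseval over the moved value.** For index sets `A`, `B` with values `vA`, `vB` and weights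
`sA`, `sB`: `Σ_{u<N} conj(Σ_{a: vA a ≡ u} sA a) · (Σ_{b: vB b ≡ u} sB b) = Σ_{a,b} [vA a ≡ vB b] conj(sA a) sB b`.
[folklore] -/
theorem sum_conj_mul_eq_sum_ite {α β : Type*} (A : Finset α) (B : Finset β) {N : ℕ} (hN : 0 < N) (vA : α → ℕ) (sA : α → ℂ)
    (vB : β → ℕ) (sB : β → ℂ) :
    ∑ u ∈ range N, (starRingEnd ℂ) (∑ a ∈ A, if vA a % N = u then sA a else 0) * (∑ b ∈ B, if vB b % N = u then sB b else 0) =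
      ∑ a ∈ A, ∑ b ∈ B, if vA a % N = vB b % N then (starRingEnd ℂ) (sA a) * sB b else 0 := by
  have hL : ∀ u, (starRingEnd ℂ) (∑ a ∈ A, if vA a % N = u then sA a else 0) =
      ∑ a ∈ A, if vA a % N = u then (starRingEnd ℂ) (sA a) else 0 := fun u => by
    rw [map_sum]; exact sum_congr rfl fun a _ => by split_ifs <;> simp
  simp_rw [hL, Finset.sum_mul_sum]
  rw [Finset.sum_comm]
  refine sum_congr rfl fun a _ => ?_
  rw [Finset.sum_comm]
  refine sum_congr rfl fun b _ => ?_
  simp_rw [ite_mul, zero_mul, mul_ite, mul_zero]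
  rw [Finset.sum_ite_eq, if_pos (mem_range.2 (Nat.mod_lt _ hN))]
  by_cases h : vA a % N = vB b % N
  · rw [if_pos h, if_pos h.symm]
  · rw [if_neg h, if_neg (Ne.symm h)]

/-- A difference phase splits: `e(f(b − a)/N) = e(f b/N) · e(−(f a)/N)`. [folklore] -/
theorem eR_int_sub (N f a b : ℕ) :
    eR ((((b : ℤ) - a : ℤ) : ℝ) * f / N) = eR ((f : ℝ) * b / N) * eR (-((f : ℝ) * a / N)) := by
  rw [← eR_add]; congr 1; push_cast; ring

namespace Layout

variable (Λ : Layout)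

/-- The test factor of the amplitude at frequency `f`: `Σ_y (-i)^{#σ∧y} (-1)^{y·γ} e(f E(y)/N)`
(`= 2^k · modeAmp`, `Mk_eq`). [cite: Kitaev1995, §3 Lemma 8] -/
def Mk (f : ℕ) (γ : QReg Λ.k) : ℂ := ∑ y : QReg Λ.k, Λ.sS y γ * eR ((f : ℝ) * Λ.Ey y / Λ.Nmod)

/-- The indicator of the good values (the coset of cubes). [folklore] -/
def indGood (d : Data) (x : ℕ) : ℂ := if x ∈ Λ.goodS d then 1 else 0

/-- The idle amplitude as one sum over (repetition index, test string). [folklore] -/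
theorem a₀_eq (d : Data) (γ : QReg Λ.k) (u : ℕ) :
    Λ.a₀ d γ u = ∑ q ∈ range (2 ^ Λ.lam) ×ˢ (univ : Finset (QReg Λ.k)),
      if (q.1 * d.p + Λ.Ey q.2) % Λ.Nmod = u then Λ.sS q.2 γ else 0 := by
  rw [a₀, Finset.sum_product]; rfl

/-- The coset amplitude as one sum over (value, repetition index, test string). [folklore] -/
theorem a₁_eq (d : Data) (γ : QReg Λ.k) (u : ℕ) :
    Λ.a₁ d γ u = ∑ q ∈ Λ.goodS d ×ˢ (range (2 ^ Λ.lam) ×ˢ (univ : Finset (QReg Λ.k))),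
      if (q.1 + q.2.1 * d.p + Λ.Ey q.2.2) % Λ.Nmod = u then Λ.sS q.2.2 γ else 0 := by
  rw [a₁, Finset.sum_product]
  refine sum_congr rfl fun s _ => ?_
  rw [Finset.sum_product]; rfl

/-- The transform of the idle branch factorises: `Σ_{j,y} sS e(f(jp + E y)/N) = S(f) · Mk(f)`. [folklore] -/
theorem sum_idle_eq (d : Data) (γ : QReg Λ.k) (f : ℕ) :
    ∑ q ∈ range (2 ^ Λ.lam) ×ˢ (univ : Finset (QReg Λ.k)), Λ.sS q.2 γ * eR ((f : ℝ) * (q.1 * d.p + Λ.Ey q.2 : ℕ) / Λ.Nmod) =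
      dirichletSum Λ.Nmod (2 ^ Λ.lam) d.p f * Λ.Mk f γ := by
  rw [dirichletSum, Mk, Finset.sum_mul_sum, Finset.sum_product]
  refine sum_congr rfl fun jv _ => sum_congr rfl fun y _ => ?_
  rw [mul_left_comm, ← eR_add]
  congr 2; push_cast; ring

/-- The transform of the coset branch factorises: `Σ_{s,j,y} sS e(f(s + jp + E y)/N) = R(f) · Mk(f)`,
`R = repFourier N 2^λ p 1_C`. [folklore] -/
theorem sum_coset_eq {d : Data} (hgood : ∀ s ∈ Λ.goodS d, s < d.p) (γ : QReg Λ.k) (f : ℕ) :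
    ∑ q ∈ Λ.goodS d ×ˢ (range (2 ^ Λ.lam) ×ˢ (univ : Finset (QReg Λ.k))),
        Λ.sS q.2.2 γ * eR ((f : ℝ) * (q.1 + q.2.1 * d.p + Λ.Ey q.2.2 : ℕ) / Λ.Nmod) =
      repFourier Λ.Nmod (2 ^ Λ.lam) d.p (Λ.indGood d) f * Λ.Mk f γ := by
  -- the indicator restricts `Σ_{x<p}` to the good values
  have hR : repFourier Λ.Nmod (2 ^ Λ.lam) d.p (Λ.indGood d) f =
      ∑ s ∈ Λ.goodS d, ∑ jv ∈ range (2 ^ Λ.lam), eR (((s : ℝ) + jv * d.p) * f / Λ.Nmod) := by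
    rw [repFourier, ← Finset.sum_filter_add_sum_filter_not (range d.p) (fun x => x ∈ Λ.goodS d),
      Finset.sum_eq_zero (s := (range d.p).filter fun x => x ∉ Λ.goodS d) (fun x hx => Finset.sum_eq_zero fun jv _ => by
        rw [indGood, if_neg (Finset.mem_filter.1 hx).2, zero_mul]), add_zero,
      show (range d.p).filter (fun x => x ∈ Λ.goodS d) = Λ.goodS d from
        Finset.ext fun x => by simp only [Finset.mem_filter, mem_range]; exact ⟨fun h => h.2, fun h => ⟨hgood x h, h⟩⟩]
    exact sum_congr rfl fun s hs => sum_congr rfl fun jv _ => by rw [indGood, if_pos hs, one_mul]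
  rw [hR, Mk, Finset.sum_mul_sum, Finset.sum_product]
  refine sum_congr rfl fun s _ => ?_
  rw [Finset.sum_product, Finset.sum_comm]
  refine sum_congr rfl fun y _ => ?_
  rw [Finset.sum_mul]
  refine sum_congr rfl fun jv _ => ?_
  rw [mul_left_comm, ← eR_add]
  congr 2; push_cast; ring

/-- **LAW₁ — the interference term summed over the moved value is a Parseval sum over frequencies**:
`Σ_{u<N} conj(a₀ γ u) a₁ γ u = N⁻¹ Σ_{f<N} ‖Mk f γ‖² conj(S f) R f` with `S = dirichletSum N 2^λ p`,
`R = repFourier N 2^λ p 1_C`. [cite: VanDamSeroussi2002, §4 Thm. 1 (proof)] [cite: Kitaev1995, §5] -/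
theorem LAW₁ {d : Data} (hgood : ∀ s ∈ Λ.goodS d, s < d.p) (γ : QReg Λ.k) :
    ∑ u ∈ range Λ.Nmod, (starRingEnd ℂ) (Λ.a₀ d γ u) * Λ.a₁ d γ u =
      (Λ.Nmod : ℂ)⁻¹ * ∑ f ∈ range Λ.Nmod, (‖Λ.Mk f γ‖ ^ 2 : ℂ) *
        ((starRingEnd ℂ) (dirichletSum Λ.Nmod (2 ^ Λ.lam) d.p f) * repFourier Λ.Nmod (2 ^ Λ.lam) d.p (Λ.indGood d) f) := by
  have hN : 0 < Λ.Nmod := by have := Λ.size_facts.1; omega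
  simp_rw [Λ.a₀_eq, Λ.a₁_eq]
  rw [sum_conj_mul_eq_sum_ite _ _ hN]
  simp_rw [ite_mod_eq_avg hN, Finset.mul_sum, Finset.sum_mul]
  -- bring the frequency sum outside
  rw [show (∑ qa ∈ range (2 ^ Λ.lam) ×ˢ (univ : Finset (QReg Λ.k)), ∑ qb ∈ Λ.goodS d ×ˢ (range (2 ^ Λ.lam) ×ˢ (univ : Finset (QReg Λ.k))),
      ∑ f ∈ range Λ.Nmod, (Λ.Nmod : ℂ)⁻¹ * eR (((((qb.1 + qb.2.1 * d.p + Λ.Ey qb.2.2 : ℕ) : ℤ) - (qa.1 * d.p + Λ.Ey qa.2 : ℕ) : ℤ) : ℝ) * f / Λ.Nmod) *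
        ((starRingEnd ℂ) (Λ.sS qa.2 γ) * Λ.sS qb.2.2 γ)) =
      ∑ qa ∈ range (2 ^ Λ.lam) ×ˢ (univ : Finset (QReg Λ.k)), ∑ f ∈ range Λ.Nmod, ∑ qb ∈ Λ.goodS d ×ˢ (range (2 ^ Λ.lam) ×ˢ (univ : Finset (QReg Λ.k))),
        (Λ.Nmod : ℂ)⁻¹ * eR (((((qb.1 + qb.2.1 * d.p + Λ.Ey qb.2.2 : ℕ) : ℤ) - (qa.1 * d.p + Λ.Ey qa.2 : ℕ) : ℤ) : ℝ) * f / Λ.Nmod) *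
          ((starRingEnd ℂ) (Λ.sS qa.2 γ) * Λ.sS qb.2.2 γ) from sum_congr rfl fun _ _ => Finset.sum_comm, Finset.sum_comm]
  refine sum_congr rfl fun f _ => ?_
  -- factorise the double sum at frequency `f`
  have hfac : ∀ (qa : ℕ × QReg Λ.k) (qb : ℕ × ℕ × QReg Λ.k),
      (Λ.Nmod : ℂ)⁻¹ * eR (((((qb.1 + qb.2.1 * d.p + Λ.Ey qb.2.2 : ℕ) : ℤ) - (qa.1 * d.p + Λ.Ey qa.2 : ℕ) : ℤ) : ℝ) * f / Λ.Nmod) *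
        ((starRingEnd ℂ) (Λ.sS qa.2 γ) * Λ.sS qb.2.2 γ) =
      (Λ.Nmod : ℂ)⁻¹ * (((starRingEnd ℂ) (Λ.sS qa.2 γ * eR ((f : ℝ) * (qa.1 * d.p + Λ.Ey qa.2 : ℕ) / Λ.Nmod))) *
        (Λ.sS qb.2.2 γ * eR ((f : ℝ) * (qb.1 + qb.2.1 * d.p + Λ.Ey qb.2.2 : ℕ) / Λ.Nmod))) := by
    intro qa qb
    rw [eR_int_sub, map_mul, conj_eR]; ring
  simp_rw [hfac, ← Finset.mul_sum, ← Finset.sum_mul]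
  rw [← map_sum, Λ.sum_idle_eq, Λ.sum_coset_eq hgood, map_mul]
  -- `conj(S·M) · (R·M) = ‖M‖² conj(S) R`
  have hMM : (starRingEnd ℂ) (Λ.Mk f γ) * Λ.Mk f γ = (‖Λ.Mk f γ‖ ^ 2 : ℂ) := by
    rw [mul_comm, Complex.mul_conj, Complex.normSq_eq_norm_sq]; push_cast; rfl
  rw [show (starRingEnd ℂ) (dirichletSum Λ.Nmod (2 ^ Λ.lam) d.p f) * (starRingEnd ℂ) (Λ.Mk f γ) *
      (repFourier Λ.Nmod (2 ^ Λ.lam) d.p (Λ.indGood d) f * Λ.Mk f γ) =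
      ((starRingEnd ℂ) (Λ.Mk f γ) * Λ.Mk f γ) * ((starRingEnd ℂ) (dirichletSum Λ.Nmod (2 ^ Λ.lam) d.p f) *
        repFourier Λ.Nmod (2 ^ Λ.lam) d.p (Λ.indGood d) f) by ring, hMM]

/-! ### The test factor is Kitaev's mode amplitude -/

/-- The weighted exponent of a test string as a sum over the tests. [folklore] -/
theorem Ey_eq_sum (y : QReg Λ.k) : Λ.Ey y = ∑ j : Fin Λ.k, (y j).toNat * 2 ^ ((j : ℕ) / Λ.Bper) := by
  unfold Ey
  rw [weightedExp_eq_sum, List.length_ofFn,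
    show (List.range Λ.k).zip (List.ofFn y) = List.ofFn (fun j : Fin Λ.k => ((j : ℕ), y j)) by
      apply List.ext_getElem
      · simp
      · intro i h1 h2
        simp [List.getElem_zip],
    List.map_ofFn, List.sum_ofFn]
  rfl

/-- **`Mk = 2^k · modeAmp`** with the weights `w_j = 2^{⌊j/2B⌋}` of the layout. [cite: Kitaev1995, §3 Lemma 8] -/
theorem Mk_eq (f : ℕ) (γ : QReg Λ.k) :
    Λ.Mk f γ = 2 ^ Λ.k * modeAmp Λ.σ (fun j : Fin Λ.k => 2 ^ ((j : ℕ) / Λ.Bper)) Λ.Nmod f γ := by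
  rw [Mk, modeAmp, ← mul_assoc, show (2 : ℂ) ^ Λ.k * (1 / 2) ^ Λ.k = 1 by rw [← mul_pow]; norm_num, one_mul]
  refine sum_congr rfl fun y _ => ?_
  rw [sS, Λ.Ey_eq_sum y, eR]
  congr 1
  push_cast
  ring

/-- **The test factors are a probability distribution up to `4^k`**: `Σ_γ ‖Mk f γ‖² = 4^k`. [cite: Kitaev1995, §3 Lemma 8] -/
theorem sum_norm_sq_Mk (f : ℕ) : ∑ γ : QReg Λ.k, ‖Λ.Mk f γ‖ ^ 2 = 4 ^ Λ.k := by
  simp_rw [Λ.Mk_eq, norm_mul, mul_pow]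
  rw [← Finset.mul_sum, sum_norm_sq_modeAmp, mul_one, Complex.norm_pow, Complex.norm_two, ← pow_mul,
    show (2 : ℝ) ^ (Λ.k * 2) = 4 ^ Λ.k by rw [mul_comm, pow_mul]; norm_num]

/-- The weight of an event `T` on the tests under the mode of frequency `f`: between `0` and `4^k`. [folklore] -/
theorem sum_ite_norm_sq_Mk_le (f : ℕ) (T : QReg Λ.k → Prop) [DecidablePred T] :
    0 ≤ ∑ γ : QReg Λ.k, (if T γ then ‖Λ.Mk f γ‖ ^ 2 else 0) ∧ ∑ γ : QReg Λ.k, (if T γ then ‖Λ.Mk f γ‖ ^ 2 else 0) ≤ 4 ^ Λ.k := by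
  refine ⟨sum_nonneg fun γ _ => by split_ifs <;> positivity, ?_⟩
  rw [← Λ.sum_norm_sq_Mk f]
  exact sum_le_sum fun γ _ => by split_ifs <;> [exact le_rfl; positivity]

end Layout

end CubicBlock

end VanDamSeroussi

end Literature.Computability.Cryptography
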